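import Summits.QuantumFields.YangMills.Theorems.IR.BetaSlopeFloorRungMoments

/-!
# Line `beta-slope-floor` (crux `IR`, stmt-QuantumFields-19354): skew re-alignment of the cut plaquettes

Route `BalabanLadder`, crux `IR`, line `beta-slope-floor` (registered stub `stub_rung_strongCoupling`), lead
prover `ym-ir-line-bsf-p1`.  Bookkeeping for the upgrade of the doubled-moment vanishing from order `< n`
(file `…RungMoments`, pure slab swap) to order `< 2n` (file `…RungMomentsTwo`): when a cut step carries ONE
timelike plaquette `p = (x; 0, j)` of the tuple, the slab swap sends its holonomy to a MIXED word
`V · Ũ_a · W⁻¹ · U_b⁻¹`; the SKEW LEFT TRANSLATION of the private base link `V = U(x,0)` by `c = M̃⁻¹ M`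
(`skewCoeff`; `M̃`, `M` = swapped / unswapped rest of the holonomy `restHol`, functions of OTHER links) re-aligns
it because `Re tr ρ` is a class function (`trace_re_realign`).  This file defines the copies `emb`, `restHol`,
`skewCoeff`, `skewAt`, the four-fold skew `skew4`, the composite symmetry `sigma = slabSwap ∘ skew4`, the cut
data `CutData`, and proves the coordinate evaluations `sigma_apply_of_ne / _x / _y`.

Honest framing: strong-coupling combinatorics on a finite torus, group-blind; nothing here bears on the
Yang–Mills mass gap (Clay).  R4 of the ladder closes only the conditional finite-𝕋⁴ rung `BalabanLadder.UV`.
Refs: K. Osterwalder, E. Seiler, Ann. Phys. 110 (1978) 440, §3; line card `Cruxes/IR/Lines/beta-slope-floor.md`.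
-/

set_option autoImplicit false

noncomputable section

open MeasureTheory Function Classical
open Literature.MathematicalPhysics.QuantumFieldTheory

namespace Summit.QuantumFields.YangMills.Cruxes.IR.BetaSlopeFloor

/-! ## §1 Copies, the rest of a timelike holonomy, skew coefficients -/

section Skew

variable {L : ℕ} {G : Type*} [Group G]

/-- The two copies of the link set inside the doubled index set. -/
def emb (b : Bool) (e : Edge 4 L) : Edge 4 L ⊕ Edge 4 L := bif b then Sum.inr e else Sum.inl e

omit [Group G] in
/-- `emb` is injective in the link. -/
theorem emb_eq_emb_iff_right {b b' : Bool} {e e' : Edge 4 L} (h : emb b e = emb b' e') : e = e' := by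
  cases b <;> cases b' <;> simp [emb] at h <;> exact h

omit [Group G] in
/-- The slab swap sends a copy of a link to some copy of the same link. -/
theorem slabPerm_emb (t t' : ℕ) (b : Bool) (e : Edge 4 L) :
    ∃ b', slabPerm t t' (emb b e) = emb b' e := by
  cases b <;> by_cases h : InSwap t t' e
  · exact ⟨true, by simp [emb, slabPerm, h]⟩
  · exact ⟨false, by simp [emb, slabPerm, h]⟩
  · exact ⟨false, by simp [emb, slabPerm, h]⟩
  · exact ⟨true, by simp [emb, slabPerm, h]⟩

/-- The rest of the holonomy of the timelike plaquette `(x; 0, j)` in copy `b`: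
`U(x+e₀, j) · U(x+e_j, 0)⁻¹ · U(x, j)⁻¹`. -/
def restHol (b : Bool) (x : Site 4 L) (j : Fin 4) (W : Edge 4 L ⊕ Edge 4 L → G) : G :=
  W (emb b (x.shift 0, j)) * (W (emb b (x.shift j, 0)))⁻¹ * (W (emb b (x, j)))⁻¹

/-- The timelike holonomy is the base link times the rest. -/
theorem plaquetteHolonomy_eq_mul_restHol (b : Bool) (x : Site 4 L) (j : Fin 4)
    (W : Edge 4 L ⊕ Edge 4 L → G) :
    plaquetteHolonomy (fun e => W (emb b e)) x 0 j = W (emb b (x, 0)) * restHol b x j W := by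
  simp only [plaquetteHolonomy, restHol, mul_assoc]

/-- The skew coefficient re-aligning the plaquette `(x; 0, j)` of copy `b` after the slab swap:
`c = M̃⁻¹ · M` with `M̃` the rest of the holonomy after the swap and `M` before. -/
def skewCoeff (t t' : ℕ) (b : Bool) (x : Site 4 L) (j : Fin 4) (W : Edge 4 L ⊕ Edge 4 L → G) : G :=
  (restHol b x j (slabSwap t t' W))⁻¹ * restHol b x j W

/-- The skew left translation of the base link `(x, 0)` of copy `b`. -/
def skewAt (t t' : ℕ) (b : Bool) (x : Site 4 L) (j : Fin 4) (W : Edge 4 L ⊕ Edge 4 L → G) :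
    Edge 4 L ⊕ Edge 4 L → G :=
  update W (emb b (x, 0)) (skewCoeff t t' b x j W * W (emb b (x, 0)))

/-- `restHol` does not read a coordinate away from its three links. -/
theorem restHol_update {b : Bool} {x : Site 4 L} {j : Fin 4} {κ : Edge 4 L ⊕ Edge 4 L}
    (h1 : ∀ b', κ ≠ emb b' (x.shift 0, j)) (h2 : ∀ b', κ ≠ emb b' (x.shift j, 0))
    (h3 : ∀ b', κ ≠ emb b' (x, j)) (W : Edge 4 L ⊕ Edge 4 L → G) (v : G) :
    restHol b x j (update W κ v) = restHol b x j W := by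
  simp only [restHol, update_of_ne (h1 b).symm, update_of_ne (h2 b).symm, update_of_ne (h3 b).symm]

/-- `restHol ∘ slabSwap` does not read a coordinate away from the copies of its three links. -/
theorem restHol_slabSwap_update (t t' : ℕ) {b : Bool} {x : Site 4 L} {j : Fin 4}
    {κ : Edge 4 L ⊕ Edge 4 L} (h1 : ∀ b', κ ≠ emb b' (x.shift 0, j))
    (h2 : ∀ b', κ ≠ emb b' (x.shift j, 0)) (h3 : ∀ b', κ ≠ emb b' (x, j))
    (W : Edge 4 L ⊕ Edge 4 L → G) (v : G) :
    restHol b x j (slabSwap t t' (update W κ v)) = restHol b x j (slabSwap t t' W) := by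
  obtain ⟨b₁, hb₁⟩ := slabPerm_emb (L := L) t t' b (x.shift 0, j)
  obtain ⟨b₂, hb₂⟩ := slabPerm_emb (L := L) t t' b (x.shift j, 0)
  obtain ⟨b₃, hb₃⟩ := slabPerm_emb (L := L) t t' b (x, j)
  simp only [restHol, slabSwap, hb₁, hb₂, hb₃, update_of_ne (h1 b₁).symm, update_of_ne (h2 b₂).symm,
    update_of_ne (h3 b₃).symm]

/-- The skew coefficient does not read a coordinate away from the copies of its three links. -/
theorem skewCoeff_update (t t' : ℕ) {b : Bool} {x : Site 4 L} {j : Fin 4}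
    {κ : Edge 4 L ⊕ Edge 4 L} (h1 : ∀ b', κ ≠ emb b' (x.shift 0, j))
    (h2 : ∀ b', κ ≠ emb b' (x.shift j, 0)) (h3 : ∀ b', κ ≠ emb b' (x, j))
    (W : Edge 4 L ⊕ Edge 4 L → G) (v : G) :
    skewCoeff t t' b x j (update W κ v) = skewCoeff t t' b x j W := by
  simp only [skewCoeff, restHol_update h1 h2 h3, restHol_slabSwap_update t t' h1 h2 h3]

/-- **Re-alignment by a class function.**  `Re tr ρ((M̃⁻¹ M) V M̃) = Re tr ρ(V M)`. -/
theorem trace_re_realign {N : ℕ} (ρ : G →* Matrix (Fin N) (Fin N) ℂ) (V M Mt : G) :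
    (ρ (Mt⁻¹ * M * V * Mt)).trace.re = (ρ (V * M)).trace.re := by
  have h1 : (ρ (Mt⁻¹ * M * V * Mt)).trace = (ρ (M * V)).trace := by
    rw [map_mul, Matrix.trace_mul_comm, ← map_mul]
    congr 2
    group
  have h2 : (ρ (M * V)).trace = (ρ (V * M)).trace := by
    rw [map_mul, Matrix.trace_mul_comm, ← map_mul]
  rw [h1, h2]

end Skew

/-! ## §2 The cut data and the composite symmetry `Σ = slabSwap ∘ skew4` -/

section Sigma

variable {L : ℕ} {G : Type*} [Group G]

/-- The four skew translations: both copies of the base links of the two cut plaquettes `(x; 0, j)` (step `t`)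
and `(y; 0, j')` (step `t'`). -/
def skew4 (t t' : ℕ) (x : Site 4 L) (j : Fin 4) (y : Site 4 L) (j' : Fin 4)
    (W : Edge 4 L ⊕ Edge 4 L → G) : Edge 4 L ⊕ Edge 4 L → G :=
  skewAt t t' true y j' (skewAt t t' false y j' (skewAt t t' true x j (skewAt t t' false x j W)))

/-- Spatially shifted sites differ from the original (`L > 1`). -/
theorem shift_ne_self (hL : 1 < L) (x : Site 4 L) (j : Fin 4) : x.shift j ≠ x := by
  haveI : Fact (1 < L) := ⟨hL⟩
  intro h
  have h1 := congrFun h j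
  simp [Site.shift] at h1

/-- A spatial link is not a timelike base link (in any copies). -/
theorem emb_spatial_ne {b b' : Bool} {z w : Site 4 L} {j : Fin 4} (hj : j ≠ 0) :
    emb b' (w, 0) ≠ emb b (z, j) := by
  intro h
  have := emb_eq_emb_iff_right h
  exact hj (Prod.ext_iff.1 this).2.symm

/-- Timelike links at different sites differ in every copy. -/
theorem emb_time_ne {b b' : Bool} {z w : Site 4 L} (h : w ≠ z) : emb b' (w, 0) ≠ emb b (z, 0) := by
  intro h'
  exact h (Prod.ext_iff.1 (emb_eq_emb_iff_right h')).1

/-- Data of the two cuts: `1 < L`, steps `t < n ≤ t' < L`, cut plaquettes `(x; 0, j)` at step `t` and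
`(y; 0, j')` at step `t'`. -/
structure CutData (L : ℕ) (n t t' : ℕ) (x : Site 4 L) (j : Fin 4) (y : Site 4 L) (j' : Fin 4) : Prop where
  hL : 1 < L
  htn : t < n
  hnt' : n ≤ t'
  ht'L : t' < L
  hx : (x 0).val = t
  hy : (y 0).val = t'
  hj : j ≠ 0
  hj' : j' ≠ 0

variable {n t t' : ℕ} {x : Site 4 L} {j : Fin 4} {y : Site 4 L} {j' : Fin 4}

/-- `x ≠ y` and the shifted sites are distinct from the base sites. -/
theorem CutData.sites_ne (c : CutData L n t t' x j y j') :
    x ≠ y ∧ x.shift j ≠ x ∧ x.shift j ≠ y ∧ y.shift j' ≠ y ∧ y.shift j' ≠ x := by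
  have hxy : x 0 ≠ y 0 := fun h => by
    have := c.hx; rw [h, c.hy] at this; have := c.htn; have := c.hnt'; omega
  refine ⟨fun h => hxy (congrFun h 0), shift_ne_self c.hL x j, fun h => hxy ?_, shift_ne_self c.hL y j',
    fun h => hxy ?_⟩
  · rw [← h, shift_time_of_ne x c.hj]
  · rw [← h, shift_time_of_ne y c.hj']

/-- **Evaluation of `skew4` off the four base links.** -/
theorem skew4_apply_of_ne (W : Edge 4 L ⊕ Edge 4 L → G)
    {i : Edge 4 L ⊕ Edge 4 L} (hx' : ∀ b, i ≠ emb b (x, 0)) (hy' : ∀ b, i ≠ emb b (y, 0)) :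
    skew4 t t' x j y j' W i = W i := by
  simp only [skew4, skewAt, update_of_ne (hy' true), update_of_ne (hy' false), update_of_ne (hx' true),
    update_of_ne (hx' false)]

/-- The skew coefficient of the cut plaquette at `x` is blind to all four base links. -/
theorem skewCoeff_x_update (c : CutData L n t t' x j y j') (b b₀ : Bool) {z : Site 4 L}
    (hz : z = x ∨ z = y) (W : Edge 4 L ⊕ Edge 4 L → G) (v : G) :
    skewCoeff t t' b x j (update W (emb b₀ (z, 0)) v) = skewCoeff t t' b x j W := by
  obtain ⟨hxy, hxx, hxy', hyy, hyx⟩ := c.sites_ne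
  refine skewCoeff_update t t' (fun _ => emb_spatial_ne c.hj) (fun _ => emb_time_ne ?_)
    (fun _ => emb_spatial_ne c.hj) W v
  rcases hz with rfl | rfl
  · exact fun h => hxx h.symm
  · exact fun h => hxy' h.symm

/-- The skew coefficient of the cut plaquette at `y` is blind to all four base links. -/
theorem skewCoeff_y_update (c : CutData L n t t' x j y j') (b b₀ : Bool) {z : Site 4 L}
    (hz : z = x ∨ z = y) (W : Edge 4 L ⊕ Edge 4 L → G) (v : G) :
    skewCoeff t t' b y j' (update W (emb b₀ (z, 0)) v) = skewCoeff t t' b y j' W := by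
  obtain ⟨hxy, hxx, hxy', hyy, hyx⟩ := c.sites_ne
  refine skewCoeff_update t t' (fun _ => emb_spatial_ne c.hj') (fun _ => emb_time_ne ?_)
    (fun _ => emb_spatial_ne c.hj') W v
  rcases hz with rfl | rfl
  · exact fun h => hyx h.symm
  · exact fun h => hyy h.symm

/-- Distinctness of the four base coordinates. -/
theorem emb_base_ne (c : CutData L n t t' x j y j') :
    emb true (x, 0) ≠ emb false (x, (0 : Fin 4)) ∧ emb false (y, (0 : Fin 4)) ≠ emb false (x, 0) ∧
      emb false (y, (0 : Fin 4)) ≠ emb true (x, 0) ∧ emb true (y, (0 : Fin 4)) ≠ emb false (x, 0) ∧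
      emb true (y, (0 : Fin 4)) ≠ emb true (x, 0) ∧ emb true (y, (0 : Fin 4)) ≠ emb false (y, 0) := by
  obtain ⟨hxy, -, -, -, -⟩ := c.sites_ne
  refine ⟨by simp [emb], emb_time_ne (Ne.symm hxy), emb_time_ne (Ne.symm hxy), emb_time_ne (Ne.symm hxy),
    emb_time_ne (Ne.symm hxy), by simp [emb]⟩

/-- **Evaluation of `skew4` at the base links of the cut plaquette at `x`.** -/
theorem skew4_apply_x (c : CutData L n t t' x j y j') (W : Edge 4 L ⊕ Edge 4 L → G) (b : Bool) :
    skew4 t t' x j y j' W (emb b (x, 0)) = skewCoeff t t' b x j W * W (emb b (x, 0)) := by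
  obtain ⟨h1, h2, h3, h4, h5, h6⟩ := emb_base_ne c
  cases b
  · simp only [skew4, skewAt, update_of_ne h2.symm, update_of_ne h4.symm, update_of_ne h1.symm, update_self]
  · simp only [skew4, skewAt, update_of_ne h3.symm, update_of_ne h5.symm, update_self,
      update_of_ne h1, skewCoeff_x_update c true false (Or.inl rfl)]

/-- **Evaluation of `skew4` at the base links of the cut plaquette at `y`.** -/
theorem skew4_apply_y (c : CutData L n t t' x j y j') (W : Edge 4 L ⊕ Edge 4 L → G) (b : Bool) :
    skew4 t t' x j y j' W (emb b (y, 0)) = skewCoeff t t' b y j' W * W (emb b (y, 0)) := by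
  obtain ⟨h1, h2, h3, h4, h5, h6⟩ := emb_base_ne c
  cases b
  · simp only [skew4, skewAt, update_of_ne h6.symm, update_self, update_of_ne h3, update_of_ne h2,
      skewCoeff_y_update c false true (Or.inl rfl), skewCoeff_y_update c false false (Or.inl rfl)]
  · simp only [skew4, skewAt, update_self, update_of_ne h6, update_of_ne h5, update_of_ne h4,
      skewCoeff_y_update c true false (Or.inr rfl), skewCoeff_y_update c true true (Or.inl rfl),
      skewCoeff_y_update c true false (Or.inl rfl)]

/-- The base links of the cut plaquettes are not swapped. -/
theorem not_inSwap_base [NeZero L] (c : CutData L n t t' x j y j') : ¬ InSwap t t' (x, (0 : Fin 4)) ∧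
    ¬ InSwap t t' (y, (0 : Fin 4)) := by
  have hv := val_add_one c.hL (y 0)
  constructor
  · simp only [InSwap, if_true, InSlab, c.hx]; omega
  · simp only [InSwap, if_true, InSlab, c.hy, hv]
    have := c.ht'L
    rcases Nat.lt_or_ge (t' + 1) L with h | h
    · rw [Nat.mod_eq_of_lt h]; omega
    · have h' : t' + 1 = L := by omega
      rw [h', Nat.mod_self]; have := c.htn; omega

/-- **The composite symmetry**: skew-translate the four base links, then swap the slab. -/
def sigma (t t' : ℕ) (x : Site 4 L) (j : Fin 4) (y : Site 4 L) (j' : Fin 4)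
    (W : Edge 4 L ⊕ Edge 4 L → G) : Edge 4 L ⊕ Edge 4 L → G :=
  slabSwap t t' (skew4 t t' x j y j' W)

/-- `Σ` agrees with the slab swap on every copy of every link other than the two base links. -/
theorem sigma_apply_of_ne (W : Edge 4 L ⊕ Edge 4 L → G) (b : Bool)
    {e : Edge 4 L} (hex : e ≠ (x, 0)) (hey : e ≠ (y, 0)) :
    sigma t t' x j y j' W (emb b e) = slabSwap t t' W (emb b e) := by
  obtain ⟨b', hb'⟩ := slabPerm_emb (L := L) t t' b e
  simp only [sigma, slabSwap, hb']
  exact skew4_apply_of_ne W (fun b'' h => hex (emb_eq_emb_iff_right h))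
    (fun b'' h => hey (emb_eq_emb_iff_right h))

/-- `Σ` on the base link of the cut plaquette at `x`: the skew translation. -/
theorem sigma_apply_x [NeZero L] (c : CutData L n t t' x j y j') (W : Edge 4 L ⊕ Edge 4 L → G) (b : Bool) :
    sigma t t' x j y j' W (emb b (x, 0)) = skewCoeff t t' b x j W * W (emb b (x, 0)) := by
  have hns := (not_inSwap_base c).1
  have hperm : slabPerm t t' (emb b (x, (0 : Fin 4))) = emb b (x, 0) := by
    cases b <;> simp [emb, slabPerm, hns]
  simp only [sigma, slabSwap, hperm]
  exact skew4_apply_x c W b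

/-- `Σ` on the base link of the cut plaquette at `y`: the skew translation. -/
theorem sigma_apply_y [NeZero L] (c : CutData L n t t' x j y j') (W : Edge 4 L ⊕ Edge 4 L → G) (b : Bool) :
    sigma t t' x j y j' W (emb b (y, 0)) = skewCoeff t t' b y j' W * W (emb b (y, 0)) := by
  have hns := (not_inSwap_base c).2
  have hperm : slabPerm t t' (emb b (y, (0 : Fin 4))) = emb b (y, 0) := by
    cases b <;> simp [emb, slabPerm, hns]
  simp only [sigma, slabSwap, hperm]
  exact skew4_apply_y c W b

end Sigma

end Summit.QuantumFields.YangMills.Cruxes.IR.BetaSlopeFloor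

end
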